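import Mathlib
import HarnessLib
import Summits.RiemannHypothesis.RiemannHypothesis.Theorems.DbrWallAntipersistenceLogTwentyFive
import Summits.RiemannHypothesis.RiemannHypothesis.Theorems.DbrWallRungsTwentySevenToFiftyThree
import Summits.RiemannHypothesis.RiemannHypothesis.Theorems.DbrWallRungsFiftyNineToEightyOne
import Summits.RiemannHypothesis.RiemannHypothesis.Theorems.DbrWallRungsEightyThreeToHundredNine
import Summits.RiemannHypothesis.RiemannHypothesis.Theorems.DbrWallRungsHundredThirteenToHundredThirtyOne

/-!
# DBR column, rung B-P(P1): anti-persistence of the zeta screw line for EVERY mesh `0 < s ≤ (log 131)/2`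
# (`Ψ(2s) < 2Ψ(s)`; every two-point lattice `{0, s, 2s}` of span `≤ log 131`)

RH-FREE calculus inequality (LINE 1 of the label discipline): a theorem about the closed form (1.1) of Suzuki's screw
function `Ψ = Literature.NumberTheory.LFunctions.zetaScrew` with its prime terms `Λ(n)n^{−1/2}(t − log n)₊`, `n ≤ 131`;
NOT worded as, and not, progress toward RH («`Ψ(2s) < 2Ψ(s)` for all `s > 0`» stays a conjecture from data; its `∀ s`
form is RH-IMPLIED, not claimed; positivity of Gram sections is an RH-consequence and is NOT what is proved).

Assembly of the ladder: the hand-written rungs up to `log 5 = (log 25)/2` (`zetaScrew_two_mul_lt_two_mul_of_le_log_five`,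
eng-2 g3) followed by the 31 generic certificate steps `step_27, …, step_131` (`DbrWallRungs…`, one kernel `decide` +
one `norm_num` each on an explicit `RungCert`, soundness `DbrWall.ladder_step`). The span `log 128 = (7/2) log 2` is the
kernel range `M ≤ 128` of Column 1 (`screwPivot_pos_of_le_128`): `κ₁(s) = 1 − Ψ(2s)/(2Ψ(s)) > 0`, i.e. the lag-one
increment covariance `c₁(s) < 0`, for every mesh `s ≤ (log 131)/2 = 2.4376`. Smallest certificate margin `0.0147`
(piece ending at `(log 103)/2`); numerically `min F = 0.0150` there. Nothing here bears on the truth of RH.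
References: M. Suzuki, J. Lond. Math. Soc. (2) 108 (2023) = arXiv:2206.03682, (1.1) [Suzuki2023]. -/

set_option linter.dupNamespace false

noncomputable section

namespace Summit.RiemannHypothesis.RiemannHypothesis.Theorems.DbrWall

open Literature.NumberTheory.LFunctions

/-- **Anti-persistence of the zeta screw line for every mesh up to `(log 131)/2`** (RH-FREE calculus inequality):
`Ψ(2s) < 2Ψ(s)` for every `0 < s ≤ (log 131)/2 = 2.4376…`. [folklore] -/
theorem zetaScrew_two_mul_lt_two_mul_of_le_half_log_131 {s : ℝ} (hs0 : 0 < s)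
    (hs : s ≤ Real.log 131 / 2) : zetaScrew (2 * s) < 2 * zetaScrew s := by
  have h25 : ∀ s : ℝ, 0 < s → s ≤ Real.log 25 / 2 → zetaScrew (2 * s) < 2 * zetaScrew s := by
    intro s hs0 hs
    have e : Real.log 25 = 2 * Real.log 5 := by
      rw [show (25 : ℝ) = 5 ^ 2 by norm_num, Real.log_pow]; norm_num
    exact zetaScrew_two_mul_lt_two_mul_of_le_log_five hs0 (by rw [e] at hs; linarith)
  have h27 : ∀ s : ℝ, 0 < s → s ≤ Real.log 27 / 2 → zetaScrew (2 * s) < 2 * zetaScrew s :=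
    fun s hs0 hs => step_27 h25 hs0 hs
  have h29 : ∀ s : ℝ, 0 < s → s ≤ Real.log 29 / 2 → zetaScrew (2 * s) < 2 * zetaScrew s :=
    fun s hs0 hs => step_29 h27 hs0 hs
  have h31 : ∀ s : ℝ, 0 < s → s ≤ Real.log 31 / 2 → zetaScrew (2 * s) < 2 * zetaScrew s :=
    fun s hs0 hs => step_31 h29 hs0 hs
  have h32 : ∀ s : ℝ, 0 < s → s ≤ Real.log 32 / 2 → zetaScrew (2 * s) < 2 * zetaScrew s :=
    fun s hs0 hs => step_32 h31 hs0 hs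
  have h37 : ∀ s : ℝ, 0 < s → s ≤ Real.log 37 / 2 → zetaScrew (2 * s) < 2 * zetaScrew s :=
    fun s hs0 hs => step_37 h32 hs0 hs
  have h41 : ∀ s : ℝ, 0 < s → s ≤ Real.log 41 / 2 → zetaScrew (2 * s) < 2 * zetaScrew s :=
    fun s hs0 hs => step_41 h37 hs0 hs
  have h43 : ∀ s : ℝ, 0 < s → s ≤ Real.log 43 / 2 → zetaScrew (2 * s) < 2 * zetaScrew s :=
    fun s hs0 hs => step_43 h41 hs0 hs
  have h47 : ∀ s : ℝ, 0 < s → s ≤ Real.log 47 / 2 → zetaScrew (2 * s) < 2 * zetaScrew s :=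
    fun s hs0 hs => step_47 h43 hs0 hs
  have h49 : ∀ s : ℝ, 0 < s → s ≤ Real.log 49 / 2 → zetaScrew (2 * s) < 2 * zetaScrew s :=
    fun s hs0 hs => step_49 h47 hs0 hs
  have h53 : ∀ s : ℝ, 0 < s → s ≤ Real.log 53 / 2 → zetaScrew (2 * s) < 2 * zetaScrew s :=
    fun s hs0 hs => step_53 h49 hs0 hs
  have h59 : ∀ s : ℝ, 0 < s → s ≤ Real.log 59 / 2 → zetaScrew (2 * s) < 2 * zetaScrew s :=
    fun s hs0 hs => step_59 h53 hs0 hs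
  have h61 : ∀ s : ℝ, 0 < s → s ≤ Real.log 61 / 2 → zetaScrew (2 * s) < 2 * zetaScrew s :=
    fun s hs0 hs => step_61 h59 hs0 hs
  have h64 : ∀ s : ℝ, 0 < s → s ≤ Real.log 64 / 2 → zetaScrew (2 * s) < 2 * zetaScrew s :=
    fun s hs0 hs => step_64 h61 hs0 hs
  have h67 : ∀ s : ℝ, 0 < s → s ≤ Real.log 67 / 2 → zetaScrew (2 * s) < 2 * zetaScrew s :=
    fun s hs0 hs => step_67 h64 hs0 hs
  have h71 : ∀ s : ℝ, 0 < s → s ≤ Real.log 71 / 2 → zetaScrew (2 * s) < 2 * zetaScrew s :=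
    fun s hs0 hs => step_71 h67 hs0 hs
  have h73 : ∀ s : ℝ, 0 < s → s ≤ Real.log 73 / 2 → zetaScrew (2 * s) < 2 * zetaScrew s :=
    fun s hs0 hs => step_73 h71 hs0 hs
  have h79 : ∀ s : ℝ, 0 < s → s ≤ Real.log 79 / 2 → zetaScrew (2 * s) < 2 * zetaScrew s :=
    fun s hs0 hs => step_79 h73 hs0 hs
  have h81 : ∀ s : ℝ, 0 < s → s ≤ Real.log 81 / 2 → zetaScrew (2 * s) < 2 * zetaScrew s :=
    fun s hs0 hs => step_81 h79 hs0 hs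
  have h83 : ∀ s : ℝ, 0 < s → s ≤ Real.log 83 / 2 → zetaScrew (2 * s) < 2 * zetaScrew s :=
    fun s hs0 hs => step_83 h81 hs0 hs
  have h89 : ∀ s : ℝ, 0 < s → s ≤ Real.log 89 / 2 → zetaScrew (2 * s) < 2 * zetaScrew s :=
    fun s hs0 hs => step_89 h83 hs0 hs
  have h97 : ∀ s : ℝ, 0 < s → s ≤ Real.log 97 / 2 → zetaScrew (2 * s) < 2 * zetaScrew s :=
    fun s hs0 hs => step_97 h89 hs0 hs
  have h101 : ∀ s : ℝ, 0 < s → s ≤ Real.log 101 / 2 → zetaScrew (2 * s) < 2 * zetaScrew s :=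
    fun s hs0 hs => step_101 h97 hs0 hs
  have h103 : ∀ s : ℝ, 0 < s → s ≤ Real.log 103 / 2 → zetaScrew (2 * s) < 2 * zetaScrew s :=
    fun s hs0 hs => step_103 h101 hs0 hs
  have h107 : ∀ s : ℝ, 0 < s → s ≤ Real.log 107 / 2 → zetaScrew (2 * s) < 2 * zetaScrew s :=
    fun s hs0 hs => step_107 h103 hs0 hs
  have h109 : ∀ s : ℝ, 0 < s → s ≤ Real.log 109 / 2 → zetaScrew (2 * s) < 2 * zetaScrew s :=
    fun s hs0 hs => step_109 h107 hs0 hs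
  have h113 : ∀ s : ℝ, 0 < s → s ≤ Real.log 113 / 2 → zetaScrew (2 * s) < 2 * zetaScrew s :=
    fun s hs0 hs => step_113 h109 hs0 hs
  have h121 : ∀ s : ℝ, 0 < s → s ≤ Real.log 121 / 2 → zetaScrew (2 * s) < 2 * zetaScrew s :=
    fun s hs0 hs => step_121 h113 hs0 hs
  have h125 : ∀ s : ℝ, 0 < s → s ≤ Real.log 125 / 2 → zetaScrew (2 * s) < 2 * zetaScrew s :=
    fun s hs0 hs => step_125 h121 hs0 hs
  have h127 : ∀ s : ℝ, 0 < s → s ≤ Real.log 127 / 2 → zetaScrew (2 * s) < 2 * zetaScrew s :=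
    fun s hs0 hs => step_127 h125 hs0 hs
  have h128 : ∀ s : ℝ, 0 < s → s ≤ Real.log 128 / 2 → zetaScrew (2 * s) < 2 * zetaScrew s :=
    fun s hs0 hs => step_128 h127 hs0 hs
  have h131 : ∀ s : ℝ, 0 < s → s ≤ Real.log 131 / 2 → zetaScrew (2 * s) < 2 * zetaScrew s :=
    fun s hs0 hs => step_131 h128 hs0 hs
  exact h131 s hs0 hs

/-- The same up to `log 128 / 2 = (7/2) log 2` (span `log 128`, Column 1's kernel range `M ≤ 128`). [folklore] -/
theorem zetaScrew_two_mul_lt_two_mul_of_le_half_log_128 {s : ℝ} (hs0 : 0 < s)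
    (hs : s ≤ 7 * Real.log 2 / 2) : zetaScrew (2 * s) < 2 * zetaScrew s := by
  have e : Real.log 128 = 7 * Real.log 2 := by
    rw [show (128 : ℝ) = 2 ^ 7 by norm_num, Real.log_pow]; norm_num
  have h : Real.log 128 ≤ Real.log 131 := Real.log_le_log (by norm_num) (by norm_num)
  exact zetaScrew_two_mul_lt_two_mul_of_le_half_log_131 hs0 (by linarith)

/-- `κ₁(s) = 1 − Ψ(2s)/(2Ψ(s)) > 0` — equivalently the lag-one increment covariance
`c₁(s) = Ψ(2s) − 2Ψ(s) + Ψ(0) < 0` — for every mesh `0 < s ≤ (log 131)/2`. [folklore] -/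
theorem lagOne_increment_cov_neg_of_le_half_log_131 {s : ℝ} (hs0 : 0 < s) (hs : s ≤ Real.log 131 / 2) :
    zetaScrew (2 * s) - 2 * zetaScrew s + zetaScrew 0 < 0 := by
  have h := zetaScrew_two_mul_lt_two_mul_of_le_half_log_131 hs0 hs
  rw [zetaScrew_zero]
  linarith

end Summit.RiemannHypothesis.RiemannHypothesis.Theorems.DbrWall
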